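import Literature.Analysis.FluidPDE.ClassicalSuitable
import HarnessLib

/-!
# Crux `FrequencyRigidity` (stmt-NavierStokesRegularity-2955), line `scaled-energy-split`:
# classical solutions on the backward slab are suitable weak solutions with `G = ∇u`

Helper file (`--supports stmt-NavierStokesRegularity-2955`; theorems only).  Stub
`stub_classicalSuitableSlab`: a classical solution `(u, p)` of Navier–Stokes with `ν = 1`, `f = 0`
on the time set `(−∞, 0)` (`Literature.Analysis.FluidPDE.IsClassicalNSSolutionOn (Iio 0) 1 0 u p`:
`u`, `p` jointly `C^∞` on `Iio 0 ×ˢ univ`, pointwise momentum equation with the one-sided time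
derivative `timeDerivWithin (Iio 0)`, divergence-free slices) is a suitable weak solution on the
whole open slab `(−∞, 0) × ℝ³` (`Literature.Analysis.FluidPDE.slab _ (Iio 0) isOpen_Iio`) in the
sense of the accepted `IsSuitableWeakSolutionOn` (Lin 1998, Def. 1; CKN 1982, (2.1)–(2.5)), and its
classical gradient `(t, x) ↦ fderiv ℝ (u t) x` is a weak spatial gradient there.

Proof.  This is the class bookkeeping of Caffarelli–Kohn–Nirenberg 1982, §2 ("if `u` is smooth,
(2.5) holds with equality"), already in the tree as `isSuitableWeakSolutionOn_of_contDiffOn` and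
`hasWeakSpatialGradientOn_of_contDiffOn` (`ClassicalSuitable.lean`), applied with `S = Iio 0` and
`Q` the slab (whose underlying set is `Iio 0 ×ˢ univ`, `coe_slab`).  The only conversion is in the
momentum equation: the tree lemma wants the two-sided `timeDeriv u t x = deriv (u · x) t`, the
structure supplies `timeDerivWithin (Iio 0) u t x = derivWithin (u · x) (Iio 0) t`; on the open set
`Iio 0` these agree (Mathlib `derivWithin_of_isOpen`).

## References

* L. Caffarelli, R. Kohn, L. Nirenberg, *Partial regularity of suitable weak solutions of the
  Navier–Stokes equations*, Comm. Pure Appl. Math. 35 (1982), §2, (2.1)–(2.5).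
  [CaffarelliKohnNirenberg1982]
* F. Lin, *A new proof of the Caffarelli–Kohn–Nirenberg theorem*, Comm. Pure Appl. Math. 51
  (1998), Def. 1. [Lin1998]
-/

noncomputable section

set_option linter.dupNamespace false

namespace Summit.NavierStokesRegularity.NavierStokesRegularity.Theorems.FrequencyRigidity.ScaledEnergySplit

open Literature.Analysis.FluidPDE MeasureTheory Set Function
open scoped Laplacian

/-- On an open time set the one-sided momentum equation of a classical solution is the two-sided
one: `timeDerivWithin S u t x = timeDeriv u t x` for `t ∈ S` (Mathlib `derivWithin_of_isOpen`),
so `∂ₜu + (u·∇)u = νΔu − ∇p + f` holds with `timeDeriv`. [folklore] -/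
theorem classicalSlab_momentum_timeDeriv
    {E : Type*} [NormedAddCommGroup E] [InnerProductSpace ℝ E] [FiniteDimensional ℝ E]
    {S : Set ℝ} (hS : IsOpen S) {ν : ℝ} {f u : ℝ → E → E} {p : ℝ → E → ℝ}
    (h : IsClassicalNSSolutionOn S ν f u p) :
    ∀ t ∈ S, ∀ x, timeDeriv u t x + convect (u t) (u t) x =
      ν • (Δ (u t)) x - gradient (p t) x + f t x := by
  intro t ht x
  have hm := h.momentum t ht x
  rwa [timeDerivWithin_apply, derivWithin_of_isOpen hS ht, ← timeDeriv_apply] at hm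

/-- **Classical solutions on the backward slab are suitable weak solutions, with weak spatial
gradient the classical one** (stub `stub_classicalSuitableSlab` of line `scaled-energy-split`):
if `(u, p)` is a classical solution of Navier–Stokes (`ν = 1`, `f = 0`) on the time set `(−∞, 0)`,
then `(u, p)` is a suitable weak solution on the open slab `(−∞, 0) × ℝ³` and
`(t, x) ↦ fderiv ℝ (u t) x` is a weak spatial gradient of `u` there (CKN 1982, §2: for smooth
solutions (2.1)–(2.4) hold and (2.5) holds with equality; tree
`isSuitableWeakSolutionOn_of_contDiffOn`, `hasWeakSpatialGradientOn_of_contDiffOn`).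
[cite: CaffarelliKohnNirenberg1982, §2 (2.1)–(2.5)] -/
theorem stub_classicalSuitableSlab : ∀ (u : ℝ → EuclideanSpace ℝ (Fin 3) → EuclideanSpace ℝ (Fin 3)) (p : ℝ → EuclideanSpace ℝ (Fin 3) → ℝ), Literature.Analysis.FluidPDE.IsClassicalNSSolutionOn (Set.Iio 0) 1 0 u p → Literature.Analysis.FluidPDE.IsSuitableWeakSolutionOn (Literature.Analysis.FluidPDE.slab (EuclideanSpace ℝ (Fin 3)) (Set.Iio 0) isOpen_Iio) 1 0 u p ∧ Literature.Analysis.FluidPDE.HasWeakSpatialGradientOn (Literature.Analysis.FluidPDE.slab (EuclideanSpace ℝ (Fin 3)) (Set.Iio 0) isOpen_Iio) u (fun t x => fderiv ℝ (u t) x) := by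
  intro u p h
  have hQ : ((slab (EuclideanSpace ℝ (Fin 3)) (Iio 0) isOpen_Iio :
      TopologicalSpace.Opens (ℝ × EuclideanSpace ℝ (Fin 3))) : Set (ℝ × EuclideanSpace ℝ (Fin 3))) ⊆
        Iio 0 ×ˢ univ := by
    rw [coe_slab]
  have hu2 : ContDiffOn ℝ 2 (uncurry u) (Iio 0 ×ˢ univ) := h.smooth_velocity.of_le (by norm_cast)
  have hu1 : ContDiffOn ℝ 1 (uncurry u) (Iio 0 ×ˢ univ) := h.smooth_velocity.of_le (by norm_cast)
  have hp1 : ContDiffOn ℝ 1 (uncurry p) (Iio 0 ×ˢ univ) := h.smooth_pressure.of_le (by norm_cast)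
  exact ⟨isSuitableWeakSolutionOn_of_contDiffOn isOpen_Iio hQ hu2 hp1 continuousOn_const
      (classicalSlab_momentum_timeDeriv isOpen_Iio h) h.divFree,
    hasWeakSpatialGradientOn_of_contDiffOn isOpen_Iio hQ hu1⟩

end Summit.NavierStokesRegularity.NavierStokesRegularity.Theorems.FrequencyRigidity.ScaledEnergySplit
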